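import Summits.CriticalPhenomena.PercolationContinuityZ3.Theorems.PercNearOneGluingNoHeavyQuantSDEC
import HarnessLib

/-!
# QUANT lane R8 on trees: the two-layer closure at floor `y ≥ 1/2`, `q = 1` ("Theorem A") — part 1, the POINTWISE inequality of the
# explicit certificate S* in abstract form (row thresholds `c`, activity `act`, column profile `need`)

builds on p205010 (kernel theorem, internal audit signed; external expert review pending)

Support file (`--supports stmt-CriticalPhenomena-4575`), QUANT lane seat prim-quant-arm-2 (gen 38), rung R8 of
`run/shared/lean/prim/quant/LADDER.md`; memo `run/shared/lean/prim/quant/prim-quant-arm-2-g38/TWO-LAYER-CLOSURE-G38.md` §7, §10.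
Theorems only, standard axioms, no sorries.

THE CERTIFICATE S* (memo §7).  Parameters: floor `1/2 ≤ y < 1` (so `u = y/(1−y) ≥ 1`), thresholds `t₁, t₂`, the lower layer `k` (`2k < t₁ + t₂`);
cells `(a, s)` of the grid; LOW cells `a + s ≤ k` (kernel `−y`), TARGET cells `a + s ≥ t₁ + t₂ − k` (kernel `1 − y`), middle cells (kernel `0`).
ROWS: a row `s` is ACTIVE (`act s`) when it carries factor 1's reflection at threshold `c s`; the abstract hypotheses are exactly what the explicit choice
`c s = min(k − s, ⌈t₁/2⌉ − 1, ⌈t₁ − k + s⌉ − 1)` (active iff this is `≥ 0` and `s ≤ k`) satisfies: (H1) `2·c s < t₁` (validity), (H2) `c s + s ≤ k` (it covers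
low cells only), (H3) `c s < t₁ − k + s` (its `+` region `a ≥ t₁ − c s` avoids low cells), (H4) an UNCOVERED low cell `(a, s)` (`¬act s ∨ c s < a`) has `2a ≥ t₁`
or `a ≥ t₁ − k + s`, (H5) active rows are `≤ k`.  COLUMNS: `need a ·` is a nonincreasing `[0,1]`-valued profile on column `a`, `= 1` at and below every
uncovered low cell (U-cell), `≥ 1/u` at and below every WINDOW cell (W-cell: active row, `a ≥ t₁ − c s`, `k < a + s < t₁ + t₂ − k`), and positive only
below some U- or W-cell; its layer cake `κ_c = need a c − need a (c+1)` is the family of factor 2's reflections of column `a`, whose total effect at row `s`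
is `(1−y)·need a ⌈t₂ − s⌉ − y·need a s`.
**`LawDec.halfCert_pointwise`**: at every cell, row value + column value ≤ kernel.  The two geometric facts behind it: a U/W-cell of column `a` at a row
`s″ ≥ t₂ − s` forces `(a, s)` into the target (`halfCert_target_of_far_cell`), and is incompatible with an active row claim at `(a, s)`
(`halfCert_no_double_claim`) — both one-line consequences of `2k < t₁ + t₂` and (H1)–(H4).
Part 2 (next file): the explicit `c`, `need`, the telescoping, and the assembly with `twoLayer_pair_of_certificate` (`…QuantTwoLayerCertificate`) into
THEOREM A: for `1/2 ≤ y < 1`, `q = 1`, the two-layer family is closed under convolution (no mean, no top-affordability needed).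
HONEST STATUS: `TwoLayerConvClosed`, `TreeBuiltFAR`, `FarTreeRow` OPEN; the RATE class log\* and the honest sentence of
`run/shared/lean/prim/quant/README.md` are unchanged.

[this work].  Nothing here is cited as a published result.  The gluing rows served [cite: KozmaNitzan2024, Conjecture 3 (p. 15)]; product measure
[cite: Grimmett1999, §1.3 p. 10].
-/

noncomputable section

namespace Summit.CriticalPhenomena.PercolationContinuityZ3.Theorems

namespace Quant

open Finset

namespace LawDec

/-! ### The two geometric facts -/

/-- **a U- or W-cell of column `a` at a row `s″ ≥ t₂ − s` forces `(a, s)` into the target `a + s ≥ t₁ + t₂ − k`.** [this work] -/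
theorem halfCert_target_of_far_cell (t₁ t₂ : ℝ) (k a s s'' : ℕ)
    (act : ℕ → Prop) (c : ℕ → ℕ)
    (H2 : ∀ s, act s → c s + s ≤ k)
    (H4 : ∀ a s : ℕ, a + s ≤ k → (¬ act s ∨ c s < a) → (t₁ ≤ 2 * (a : ℝ) ∨ t₁ - k + s ≤ (a : ℝ)))
    (hfar : t₂ - s ≤ (s'' : ℝ))
    (hcell : (a + s'' ≤ k ∧ (¬ act s'' ∨ c s'' < a)) ∨ (act s'' ∧ t₁ - c s'' ≤ (a : ℝ) ∧ k < a + s'' ∧ (a : ℝ) + s'' < t₁ + t₂ - k)) :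
    t₁ + t₂ - k ≤ (a : ℝ) + s := by
  rcases hcell with ⟨hlow, hunc⟩ | ⟨hact, hge, _, _⟩
  · rcases H4 a s'' hlow hunc with h2a | hts
    · have : (a : ℝ) + s'' ≤ k := by exact_mod_cast hlow
      linarith
    · linarith
  · have h2 := H2 s'' hact
    have : (c s'' : ℝ) + s'' ≤ k := by exact_mod_cast h2
    linarith

/-- **no double claim on a target cell**: an active row claim at `(a, s)` (`a ≥ t₁ − c s`) is incompatible with a U- or W-cell of column `a` at a
row `s″ ≥ t₂ − s`. [this work] -/
theorem halfCert_no_double_claim (t₁ t₂ : ℝ) (k a s s'' : ℕ) (hk : 2 * (k : ℝ) < t₁ + t₂)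
    (act : ℕ → Prop) (c : ℕ → ℕ)
    (H2 : ∀ s : ℕ, act s → c s + s ≤ k)
    (hact : act s) (hclaim : t₁ - c s ≤ (a : ℝ))
    (hfar : t₂ - s ≤ (s'' : ℝ))
    (hcell : (a + s'' ≤ k ∧ (¬ act s'' ∨ c s'' < a)) ∨ (act s'' ∧ t₁ - c s'' ≤ (a : ℝ) ∧ k < a + s'' ∧ (a : ℝ) + s'' < t₁ + t₂ - k)) :
    False := by
  have h2 := H2 s hact
  have h2' : (c s : ℝ) + s ≤ k := by exact_mod_cast h2
  rcases hcell with ⟨hlow, _⟩ | ⟨_, _, _, hlt⟩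
  · have : (a : ℝ) + s'' ≤ k := by exact_mod_cast hlow
    linarith
  · linarith

/-! ### The pointwise inequality -/

/-- **THE POINTWISE INEQUALITY OF THE CERTIFICATE S* (abstract form).**  `1/2 ≤ y < 1`, `2k < t₁ + t₂`; row data `(act, c)` with (H1)–(H5); a column
profile `need` with (N0) `0 ≤ need`, (N1) `need ≤ 1`, (NU) `= 1` at U-cells, (NW) `≥ (1−y)/y` at W-cells, (Nmono) nonincreasing in the row, (Npos) positive
only at or below a U/W-cell.  Then at every cell `(a, s)`:
`rowval + (1−y)·need a ⌈t₂ − s⌉₊ − y·need a s ≤ (1−y)·[t₁ + t₂ − k ≤ a + s] − y·[a + s ≤ k]`,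
`rowval = (1−y)·[t₁ − c s ≤ a] − y·[a ≤ c s]` on active rows, `0` otherwise. [this work] -/
theorem halfCert_pointwise (y t₁ t₂ : ℝ) (k a s : ℕ) (hy : 1 / 2 ≤ y) (hy1 : y < 1) (hk : 2 * (k : ℝ) < t₁ + t₂)
    (act : ℕ → Prop) [DecidablePred act] (c : ℕ → ℕ)
    (H1 : ∀ s : ℕ, act s → 2 * (c s : ℝ) < t₁) (H2 : ∀ s : ℕ, act s → c s + s ≤ k) (H3 : ∀ s : ℕ, act s → (c s : ℝ) < t₁ - k + s)
    (H4 : ∀ a s : ℕ, a + s ≤ k → (¬ act s ∨ c s < a) → (t₁ ≤ 2 * (a : ℝ) ∨ t₁ - k + s ≤ (a : ℝ)))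
    (need : ℕ → ℕ → ℝ)
    (N0 : ∀ a s : ℕ, 0 ≤ need a s) (N1 : ∀ a s : ℕ, need a s ≤ 1)
    (NU : ∀ a s : ℕ, a + s ≤ k → (¬ act s ∨ c s < a) → need a s = 1)
    (NW : ∀ a s : ℕ, act s → t₁ - c s ≤ (a : ℝ) → k < a + s → (a : ℝ) + s < t₁ + t₂ - k → (1 - y) / y ≤ need a s)
    (Npos : ∀ a s : ℕ, 0 < need a s → ∃ s'', s ≤ s'' ∧
      ((a + s'' ≤ k ∧ (¬ act s'' ∨ c s'' < a)) ∨ (act s'' ∧ t₁ - c s'' ≤ (a : ℝ) ∧ k < a + s'' ∧ (a : ℝ) + s'' < t₁ + t₂ - k))) :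
    (if act s then (1 - y) * (if t₁ - c s ≤ (a : ℝ) then (1 : ℝ) else 0) - y * (if a ≤ c s then (1 : ℝ) else 0) else 0)
      + (1 - y) * need a ⌈t₂ - s⌉₊ - y * need a s
      ≤ (1 - y) * (if t₁ + t₂ - k ≤ (a : ℝ) + s then (1 : ℝ) else 0) - y * (if a + s ≤ k then (1 : ℝ) else 0) := by
  have hy0 : 0 < y := by linarith
  have h1y : 0 < 1 - y := by linarith
  have hyy : 1 - y ≤ y := by linarith
  -- the row value is one of `1 − y` (claim), `−y` (cover), `0`
  -- Case split on whether the column's far profile is positive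
  by_cases hP : 0 < need a ⌈t₂ - s⌉₊
  · -- a U/W cell of column `a` at a row `s″ ≥ ⌈t₂ − s⌉ ≥ t₂ − s`: `(a,s)` is a target cell and the row does not claim it
    obtain ⟨s'', hs'', hcell⟩ := Npos a _ hP
    have hfar : t₂ - s ≤ (s'' : ℝ) := le_trans (Nat.le_ceil _) (by exact_mod_cast hs'')
    have htgt := halfCert_target_of_far_cell t₁ t₂ k a s s'' act c H2 H4 hfar hcell
    rw [if_pos htgt]
    have hnotlow : ¬ (a + s ≤ k) := by
      intro h
      have : (a : ℝ) + s ≤ k := by exact_mod_cast h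
      linarith
    rw [if_neg hnotlow]
    have hrow : (if act s then (1 - y) * (if t₁ - c s ≤ (a : ℝ) then (1 : ℝ) else 0) - y * (if a ≤ c s then (1 : ℝ) else 0) else 0) ≤ 0 := by
      split_ifs with hact hclaim hcov hcov'
      · exact (halfCert_no_double_claim t₁ t₂ k a s s'' hk act c H2 hact hclaim hfar hcell).elim
      · exact (halfCert_no_double_claim t₁ t₂ k a s s'' hk act c H2 hact hclaim hfar hcell).elim
      · linarith
      · linarith
      · exact le_rfl
    nlinarith [N1 a ⌈t₂ - s⌉₊, N0 a s, hrow]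
  · have hP0 : need a ⌈t₂ - s⌉₊ = 0 := le_antisymm (not_lt.1 hP) (N0 a _)
    rw [hP0, mul_zero, add_zero]
    by_cases htgt : t₁ + t₂ - k ≤ (a : ℝ) + s
    · -- target cell: row value ≤ 1 − y, column value ≤ 0
      rw [if_pos htgt]
      have hnotlow : ¬ (a + s ≤ k) := by
        intro h
        have : (a : ℝ) + s ≤ k := by exact_mod_cast h
        linarith
      rw [if_neg hnotlow]
      have hrow : (if act s then (1 - y) * (if t₁ - c s ≤ (a : ℝ) then (1 : ℝ) else 0) - y * (if a ≤ c s then (1 : ℝ) else 0) else 0)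
          ≤ 1 - y := by
        split_ifs <;> nlinarith
      nlinarith [N0 a s]
    · rw [if_neg htgt]
      by_cases hlow : a + s ≤ k
      · -- low cell: kernel −y; covered by the row (a ≤ c s) or a U-cell (need = 1)
        rw [if_pos hlow]
        by_cases hcov : act s ∧ a ≤ c s
        · obtain ⟨hact, hac⟩ := hcov
          have hnc : ¬ (t₁ - c s ≤ (a : ℝ)) := by
            intro h
            have h1 := H1 s hact
            have : (a : ℝ) ≤ c s := by exact_mod_cast hac
            linarith
          rw [if_pos hact, if_neg hnc, if_pos hac]
          nlinarith [N0 a s]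
        · have hunc : ¬ act s ∨ c s < a := by
            by_cases hact : act s
            · right; by_contra h; exact hcov ⟨hact, not_lt.1 h⟩
            · left; exact hact
          have hN := NU a s hlow hunc
          rw [hN]
          have hrow : (if act s then (1 - y) * (if t₁ - c s ≤ (a : ℝ) then (1 : ℝ) else 0) - y * (if a ≤ c s then (1 : ℝ) else 0) else 0)
              ≤ 0 := by
            split_ifs with hact hclaim hac
            · -- claim on a low cell contradicts (H3)
              exfalso
              have h3 := H3 s hact
              have : (a : ℝ) + s ≤ k := by exact_mod_cast hlow
              linarith
            · exfalso
              have h3 := H3 s hact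
              have : (a : ℝ) + s ≤ k := by exact_mod_cast hlow
              linarith
            · linarith
            · linarith
            · exact le_rfl
          linarith
      · -- middle cell: kernel 0
        rw [if_neg hlow]
        by_cases hwin : act s ∧ t₁ - c s ≤ (a : ℝ)
        · -- window cell: row claims 1 − y, the column profile pays ≥ (1−y)/y·y
          obtain ⟨hact, hclaim⟩ := hwin
          have hks : k < a + s := by omega
          have hlt : (a : ℝ) + s < t₁ + t₂ - k := not_le.1 htgt
          have hW := NW a s hact hclaim hks hlt
          have hnc : ¬ (a ≤ c s) := by
            intro h
            have h1 := H1 s hact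
            have : (a : ℝ) ≤ c s := by exact_mod_cast h
            linarith
          rw [if_pos hact, if_pos hclaim, if_neg hnc]
          have : (1 - y) ≤ y * need a s := by
            have := mul_le_mul_of_nonneg_left hW hy0.le
            rwa [mul_div_cancel₀ _ hy0.ne'] at this
          linarith
        · have hrow : (if act s then (1 - y) * (if t₁ - c s ≤ (a : ℝ) then (1 : ℝ) else 0) - y * (if a ≤ c s then (1 : ℝ) else 0) else 0)
              ≤ 0 := by
            split_ifs with hact hclaim hac hac'
            · exact (hwin ⟨hact, hclaim⟩).elim
            · exact (hwin ⟨hact, hclaim⟩).elim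
            · nlinarith
            · linarith
            · exact le_rfl
          nlinarith [N0 a s]

end LawDec

end Quant

end Summit.CriticalPhenomena.PercolationContinuityZ3.Theorems
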